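import Literature.MathematicalPhysics.KineticTheory.HardSphereBBGKYLiouvilleLevel
import Literature.MathematicalPhysics.KineticTheory.HardSphereBBGKYLiouvillePrelim
import HarnessLib

/-!
# `bbgky_hierarchy_of_liouville` holds (**hilbert6.S07**): from the Liouville equation to the
# mild BBGKY hierarchy for hard spheres on `T^d`

Final file of the proof of `Literature.MathematicalPhysics.KineticTheory.bbgky_hierarchy_of_liouville`
(equivalently K3's `Literature.Analysis.FluidPDE.liouville_imp_bbgky`, `HardSphereBBGKYLiouville`).
For `0 < ε ≤ 1/2`, hard-sphere flows `Φ s` on `T^d`, and a symmetric Lanford-class density `W`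
(continuous on `D_ε^N`, zero off it, integrable, `|W| ≤ C e^{-βE}`), we construct versions
`F^{(s)}(t)` of the honest marginals `(1_{good} W ∘ Φ^N_{-t})^{(s)}` solving the mild BBGKY
hierarchy at every good `Z_s` (`IsMildBBGKYSolutionOnGood`), level by level (`exists_level_data`):

* top level `s = N`: `F^{(N)}(t) = 1_{good} W ∘ Φ^N_{-t}` (`C_{N,N+1} = 0`, `f^{(N)} = f`);
* level `0`: the conserved total mass (Liouville);
* levels `1 ≤ s ≤ N - 1`: the Duhamel right-hand side built in `HardSphereBBGKYLiouvilleLevel` on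
  the Lipschitz version of the marginal along the tagged flow, with free boundary data on the
  null set of contact configurations of one tagged pair (`exists_boundaryData`) — the collision
  operator reads `F^{(s+1)}` with non-zero weight only there (`bbgkyOp_congr_of_eqOn_compl_good`);
* degenerate geometries (Lebesgue-null good set of `Φ N`): all marginals vanish a.e., `F = 0`.

Off the good sets `F^{(s)}(t)` is the boundary datum of level `s - 1`; the a.e. agreement off
the good sets uses that marginals vanish off `D_ε^s` (`transportedMarginal_eq_zero_of_not_mem`)
and that `D_ε^s ∖ good` and the supports of the boundary data are null.

Honesty note (see `HardSphereBBGKYLiouvilleFlow`): the fact is proved *as stated*; the statement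
constrains `F^{(s+1)}` only almost everywhere, and the boundary values used here are not the
physical trace of the marginal. The physical almost-everywhere hierarchy with canonical boundary
values (`MildBBGKYae` of `LiouvilleBBGKY`, CIP 1994 Thm 4.3.1 / Spohn 2006 Prop. 5) is a strictly
stronger statement and is not proved here.

## References

* C. Cercignani, R. Illner, M. Pulvirenti, *The Mathematical Theory of Dilute Gases*, Springer
  (1994), §4.3, Thm 4.3.1, App. 4.A–4.B.
* I. Gallagher, L. Saint-Raymond, B. Texier, *From Newton to Boltzmann*, EMS (2013),
  arXiv:1208.5753, Part II Ch. 4 §§1–3, (4.3.5)–(4.3.8).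
* H. Spohn, *On the integrated form of the BBGKY hierarchy for hard spheres*,
  arXiv:math-ph/0605068, Prop. 5.
-/

open MeasureTheory Set Filter Topology Metric
open scoped ENNReal InnerProductSpace

namespace Literature.MathematicalPhysics.KineticTheory

open Literature.Analysis.FluidPDE

noncomputable section

variable {d : Type*} [Fintype d]

section Assembly

variable {ε β CW : ℝ} {N : ℕ}

/-- The collision operator of the zero function vanishes. [folklore] -/
theorem bbgkyOp_zero {X : Type*} [MeasureSpace X] (G : Geometry d X) (ε : ℝ) (N s : ℕ)
    (Zs : Config s d X) : bbgkyOp G ε N s (fun _ => (0 : ℝ)) Zs = 0 := by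
  simp [bbgkyOp, bbgkyCollisionOp, hsCollisionTerm]

/-- At level `0` the collision operator is an empty sum. [folklore] -/
theorem bbgkyOp_level_zero {X : Type*} [MeasureSpace X] (G : Geometry d X) (ε : ℝ) (N : ℕ)
    (g : Config 1 d X → ℝ) (Z : Config 0 d X) : bbgkyOp G ε N 0 g Z = 0 := by
  simp [bbgkyOp]

/-- Marginals of an a.e. vanishing integrable function vanish a.e. [folklore] -/
theorem nthMarginal_ae_eq_zero {s : ℕ} (hs : s ≤ N) {g : Config N d (UnitAddTorus d) → ℝ}
    (hgi : Integrable g) (hg0 : g =ᵐ[volume] 0) :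
    nthMarginal N s g =ᵐ[volume] 0 := by
  haveI : SigmaFinite (volume : Measure (UnitAddTorus d × EuclideanSpace ℝ d)) := inferInstance
  have habs : ∀ Z, |nthMarginal N s g Z| ≤ nthMarginal N s (fun z => |g z|) Z := by
    intro Z
    rw [nthMarginal_of_le hs, nthMarginal_of_le hs]
    simp only [marginal]
    exact abs_integral_le_integral_abs
  have hint : ∫ Z, nthMarginal N s (fun z => |g z|) Z = 0 := by
    rw [integral_nthMarginal hs hgi.abs]
    rw [integral_eq_zero_of_ae]
    filter_upwards [hg0] with z hz
    simp [hz]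
  have hnn : 0 ≤ nthMarginal N s (fun z => |g z|) := fun Z => nthMarginal_nonneg _ _ (fun z => abs_nonneg _) Z
  have hi : Integrable (nthMarginal N s (fun z => |g z|)) := integrable_nthMarginal hs hgi.abs
  have h0 := (integral_eq_zero_iff_of_nonneg hnn hi).1 hint
  filter_upwards [h0] with Z hZ
  simp only [Pi.zero_apply] at hZ ⊢
  exact abs_eq_zero.1 (le_antisymm ((habs Z).trans hZ.le) (abs_nonneg _))

/-- **Level data.** For every `s` there are a version `Fs` on `Config s`, boundary data `hb` on
`Config (s+1)` supported in a fixed measurable null set `H`, such that the Duhamel identity with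
source `C_{s,s+1} hb(τ)` holds at every good `Z_s` and every `t`, and `Fs t` agrees a.e. on the
good set with the honest marginal `(1_{good} W ∘ Φ^N_{-t})^{(s)}` (all levels `s`; for `s > N`
everything is `0`). See the module docstring for the four cases. [cite: CIP1994, Thm 4.3.1] -/
theorem exists_level_data (hε : 0 < ε) (hε2 : ε ≤ 1 / 2) (hβ : 0 < β)
    (Φ : (s : ℕ) → HardSphereFlow (Torus.geometry d) ε s) {W : Config N d (UnitAddTorus d) → ℝ}
    (hW : Measurable W) (hWi : Integrable W) (hCW : 0 ≤ CW)
    (hWb : ∀ z, |W z| ≤ CW * Real.exp (-β * configEnergy z)) (s : ℕ) :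
    ∃ (Fs : ℝ → Config s d (UnitAddTorus d) → ℝ) (hb : ℝ → Config (s + 1) d (UnitAddTorus d) → ℝ)
      (H : Set (Config (s + 1) d (UnitAddTorus d))),
      MeasurableSet H ∧ volume H = 0 ∧ (∀ τ Z, hb τ Z ≠ 0 → Z ∈ H) ∧
      (∀ (t : ℝ) (Z : Config s d (UnitAddTorus d)), Z ∈ (Φ s).good →
        Fs t Z = Fs 0 ((Φ s).flow (-t) Z) +
          ∫ τ in (0 : ℝ)..t, bbgkyOp (Torus.geometry d) ε N s (hb τ) ((Φ s).flow (-(t - τ)) Z)) ∧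
      (∀ t : ℝ, ∀ᵐ Z : Config s d (UnitAddTorus d), Z ∈ (Φ s).good →
        Fs t Z = nthMarginal N s ((Φ N).good.indicator fun z => W ((Φ N).flow (-t) z)) Z) := by
  classical
  haveI : SigmaFinite (volume : Measure (UnitAddTorus d × EuclideanSpace ℝ d)) := inferInstance
  -- the trivial data (used in three of the cases)
  have htriv : ∀ (c : ℝ), (∀ t : ℝ, ∀ᵐ Z : Config s d (UnitAddTorus d), Z ∈ (Φ s).good →
      c = nthMarginal N s ((Φ N).good.indicator fun z => W ((Φ N).flow (-t) z)) Z) →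
      ∃ (Fs : ℝ → Config s d (UnitAddTorus d) → ℝ) (hb : ℝ → Config (s + 1) d (UnitAddTorus d) → ℝ)
        (H : Set (Config (s + 1) d (UnitAddTorus d))),
        MeasurableSet H ∧ volume H = 0 ∧ (∀ τ Z, hb τ Z ≠ 0 → Z ∈ H) ∧
        (∀ (t : ℝ) (Z : Config s d (UnitAddTorus d)), Z ∈ (Φ s).good →
          Fs t Z = Fs 0 ((Φ s).flow (-t) Z) +
            ∫ τ in (0 : ℝ)..t, bbgkyOp (Torus.geometry d) ε N s (hb τ) ((Φ s).flow (-(t - τ)) Z)) ∧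
        (∀ t : ℝ, ∀ᵐ Z : Config s d (UnitAddTorus d), Z ∈ (Φ s).good →
          Fs t Z = nthMarginal N s ((Φ N).good.indicator fun z => W ((Φ N).flow (-t) z)) Z) := by
    intro c hc
    refine ⟨fun _ _ => c, fun _ _ => 0, ∅, MeasurableSet.empty, measure_empty, fun τ Z h => (h rfl).elim, ?_, hc⟩
    intro t Z _
    simp [bbgkyOp_zero]
  by_cases hsN : N < s
  · -- above the top level: everything vanishes
    refine htriv 0 fun t => Eventually.of_forall fun Z _ => ?_
    simp [nthMarginal, not_le.2 hsN]
  push Not at hsN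
  -- the transported density and its basic properties
  have hfi : ∀ t, Integrable ((Φ N).good.indicator fun z => W ((Φ N).flow (-t) z)) :=
    fun t => integrable_indicator_transport (Φ N) hW hWi t
  by_cases hdeg : volume (Φ N).good = 0
  · -- degenerate geometry: the marginals vanish a.e.
    refine htriv 0 fun t => ?_
    have h0 : ((Φ N).good.indicator fun z => W ((Φ N).flow (-t) z)) =ᵐ[volume] 0 := by
      rw [EventuallyEq, ae_iff]
      refine measure_mono_null (fun z hz => ?_) hdeg
      by_contra hzg
      exact hz (by simp [indicator_of_notMem hzg])
    filter_upwards [nthMarginal_ae_eq_zero hsN (hfi t) h0] with Z hZ _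
    rw [hZ]; rfl
  -- non-degenerate geometry
  rcases hsN.eq_or_lt with rfl | hlt
  · -- top level `s = N`
    refine ⟨fun t Z => (Φ s).good.indicator (fun Z => W ((Φ s).flow (-t) Z)) Z, fun _ _ => 0, ∅,
      MeasurableSet.empty, measure_empty, fun τ Z h => (h rfl).elim, ?_, ?_⟩
    · intro t Z hZ
      have hZt : (Φ s).flow (-t) Z ∈ (Φ s).good := (Φ s).mapsTo_good (-t) hZ
      simp only [bbgkyOp_zero, intervalIntegral.integral_zero, add_zero, indicator_of_mem hZ,
        indicator_of_mem hZt, neg_zero]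
      rw [(Φ s).flow_zero _ hZt]
    · intro t
      exact Eventually.of_forall fun Z _ => (nthMarginal_self_apply _ Z).symm
  rcases Nat.eq_zero_or_pos s with rfl | hspos
  · -- level `0`: conservation of mass
    refine htriv (∫ z, (Φ N).good.indicator W z) fun t => Eventually.of_forall fun Z _ => ?_
    rw [nthMarginal_zero_apply, integral_indicator (Φ N).measurableSet_good,
      integral_indicator (Φ N).measurableSet_good]
    exact ((Φ N).setIntegral_comp_flow (-t) hW).symm
  · -- intermediate level `1 ≤ s < N`
    obtain ⟨m, rfl⟩ : ∃ m, N = s + m := ⟨N - s, by omega⟩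
    have hm : 1 ≤ m := by omega
    -- the spatial dimension is positive
    have hd : 1 ≤ Fintype.card d := by
      by_contra hd0
      push Not at hd0
      have hD := hardSphereDomain_eq_empty_of_card_eq_zero (G := Torus.geometry d) hε (by omega)
        (N := s + m) (by omega)
      apply hdeg
      exact measure_mono_null (fun z hz => by simpa [hD] using (Φ (s + m)).good_subset hz) measure_empty
    -- antipodal directions are null
    have hBadω : sphereMeasure {ω : sphere (0 : EuclideanSpace ℝ d) 1 |
        Torus.reprSym (Literature.Analysis.FunctionSpaces.Torus.proj (ε • (ω : EuclideanSpace ℝ d))) ≠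
          ε • (ω : EuclideanSpace ℝ d)} = 0 := by
      refine sphereMeasure_setOf_reprSym_proj_ne_eq_zero' hε.le hε2 ?_
      by_contra hno
      push Not at hno
      obtain ⟨hεge, hdlt⟩ := hno
      have hε12 : ε = 1 / 2 := le_antisymm hε2 hεge
      have hd1 : Fintype.card d = 1 := by omega
      apply hdeg
      have hD := volume_hardSphereDomain_eq_zero_of_card_eq_one (d := d) hd1 (N := s + m) (by omega)
      rw [← hε12] at hD
      exact measure_mono_null (Φ (s + m)).good_subset hD
    obtain ⟨Fs, hb, H, hHm, hH0, hsupp, hduh, hae⟩ := exists_level_version hε hε2 hβ hd hspos hm hBadω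
      (Φ s) (Φ (s + m)) hW hWi hCW hWb
    exact ⟨Fs, hb, H, hHm, hH0, hsupp, hduh, hae⟩

/-- **hilbert6.S07 / K3's `liouville_imp_bbgky` hold: from the Liouville equation to the mild BBGKY
hierarchy for hard spheres on the flat torus** (GST 2013 Part II Ch. 4 §§2–3; CIP 1994 §4.3,
Thm 4.3.1; Spohn 2006 Prop. 5). For `0 < ε ≤ 1/2`, hard-sphere flows `Φ s` on `T^d`, `T ≥ 0` and a
symmetric Lanford-class initial density `W` (continuous on `D_ε^N`, vanishing off it, integrable,
`|W| ≤ C e^{-βE}`), the marginals of `1_{good} · W ∘ Φ^N_{-t}` admit versions forming a mild solution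
of the BBGKY hierarchy on the good sets. The versions are assembled from the level data of
`exists_level_data` — on the good set of `Φ s` the level-`s` Duhamel right-hand side, off it the
boundary datum of level `s - 1` — using that the collision operator `C_{s,s+1}` reads `F^{(s+1)}`
with non-zero weight only off the good set of `Φ (s+1)` (`bbgkyOp_congr_of_eqOn_compl_good`).
See the module docstring for the honesty note on the strength of the statement. [cite: CIP1994, Thm 4.3.1] -/
theorem bbgky_hierarchy_of_liouville_holds : bbgky_hierarchy_of_liouville (d := d) := by
  rw [bbgky_hierarchy_of_liouville_iff_liouville_imp_bbgky]
  intro ε hε hε' N Φ T hT W _hW hWc hWi hWb hWD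
  classical
  have hWm : Measurable W :=
    measurable_of_continuousOn_of_eq_zero
      (measurableSet_hardSphereDomain _ Torus.measurable_geometry_sepVec _ _) hWc hWD
  obtain ⟨C, β, hβ, hWb'⟩ := hWb
  have hWb2 : ∀ z, |W z| ≤ max C 0 * Real.exp (-β * configEnergy z) := fun z =>
    (hWb' z).trans (mul_le_mul_of_nonneg_right (le_max_left _ _) (Real.exp_pos _).le)
  have hε2 : ε ≤ 1 / 2 := by rw [one_div]; exact hε'
  have hlev := exists_level_data (N := N) hε hε2 hβ Φ hWm hWi (le_max_right C 0) hWb2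
  choose Fs hb H hHm hH0 hsupp hduh hae using hlev
  -- the boundary datum of the previous level, as a function on `Config s`
  let hbp : (s : ℕ) → ℝ → Config s d (UnitAddTorus d) → ℝ := fun s =>
    match s with
    | 0 => fun _ _ => 0
    | k + 1 => hb k
  let Hp : (s : ℕ) → Set (Config s d (UnitAddTorus d)) := fun s =>
    match s with
    | 0 => ∅
    | k + 1 => H k
  have hHp0 : ∀ s, volume (Hp s) = 0 := fun s => by
    cases s with
    | zero => exact measure_empty
    | succ k => exact hH0 k
  have hbpsupp : ∀ s τ Z, hbp s τ Z ≠ 0 → Z ∈ Hp s := fun s => by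
    cases s with
    | zero => intro τ Z h; exact (h rfl).elim
    | succ k => exact hsupp k
  -- the versions
  let F : (s : ℕ) → ℝ → Config s d (UnitAddTorus d) → ℝ := fun s t Z =>
    if Z ∈ (Φ s).good then Fs s t Z else hbp s t Z
  have hF_good : ∀ s t Z, Z ∈ (Φ s).good → F s t Z = Fs s t Z := fun s t Z hZ => if_pos hZ
  have hF_bad : ∀ s t Z, Z ∉ (Φ s).good → F s t Z = hbp s t Z := fun s t Z hZ => if_neg hZ
  have hF_succ_bad : ∀ s t Z, Z ∉ (Φ (s + 1)).good → F (s + 1) t Z = hb s t Z := fun s t Z hZ => if_neg hZ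
  refine ⟨F, ?_, ?_⟩
  · -- the Duhamel identity on the good sets
    intro s _ t _ Zs hZs
    have hZt : (Φ s).flow (-t) Zs ∈ (Φ s).good := (Φ s).mapsTo_good (-t) hZs
    rw [hF_good s t Zs hZs, hsTransport_apply, hF_good s 0 _ hZt, hduh s t Zs hZs]
    congr 1
    refine intervalIntegral.integral_congr fun τ _ => ?_
    simp only [hsTransport_apply]
    exact (Φ (s + 1)).bbgkyOp_congr_of_eqOn_compl_good hε (fun Z hZ => (hF_succ_bad s τ Z hZ).symm) N _
  · -- agreement a.e. with the honest marginals
    intro s _ t _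
    have h1 := hae s t
    have h2 : ∀ᵐ Z : Config s d (UnitAddTorus d), Z ∉ hardSphereDomain (Torus.geometry d) s ε \ (Φ s).good :=
      measure_eq_zero_iff_ae_notMem.1 (Φ s).volume_diff_good
    have h3 : ∀ᵐ Z : Config s d (UnitAddTorus d), Z ∉ Hp s := measure_eq_zero_iff_ae_notMem.1 (hHp0 s)
    filter_upwards [h1, h2, h3] with Z hZ1 hZ2 hZ3
    by_cases hZ : Z ∈ (Φ s).good
    · rw [hF_good s t Z hZ]
      exact hZ1 hZ
    · rw [hF_bad s t Z hZ]
      have hZD : Z ∉ hardSphereDomain (Torus.geometry d) s ε := fun hD => hZ2 ⟨hD, hZ⟩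
      have hmarg := transportedMarginal_eq_zero_of_not_mem Φ W t hZD (s := s)
      simp only [transportedMarginal] at hmarg
      rw [hmarg]
      by_contra hne
      exact hZ3 (hbpsupp s t Z hne)

end Assembly

end

end Literature.MathematicalPhysics.KineticTheory
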